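import Mathlib
import HarnessLib
import Literature.MathematicalPhysics.QuantumLattice.HubbardUVSymbolSmooth

/-!
# Route `KLProgramme` — crux C4a, S3 brick (B4) «(B4)-UMK1», «(M1)-TRUE-KERNEL» structural half: the Matsubara-summed above-scale pp PAIR KERNEL is of
# RATIO FORM `K_Ω(e,u) = N_Ω(e,u)/(e + u − iΩ)` for the model's actual frequency–momentum cutoff, and the numerator's level derivatives on the split support

Cell `gate-hubbard-kl`, seat hubbard-kl-k3c3-p1 (g15; row «δμ-flow with klAngularMean constant piece»).  Located brick for the (U1) chain of hubbard-kl-k3c3-p3 and the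
(C)-closer lane (stub (C) `stub_twoLeg_curvature` of `KLRegimeEngineV17F2`, stmt-HubbardSuperconductivity-20437; memo HOME/hubbard-kl-k3c3-p3/U1-CAUSTIC-SUP.md §4/§9
«NOT typed: the (B3) kernel in ratio form for (M1)»; this seat's located note `M1-TRUE-KERNEL.md`, evidence #45 on the item).

OBJECTS (tree vocabulary `Literature.MathematicalPhysics.QuantumLattice.HubbardUVSymbolSmooth`): the above-scale line profile in the level variable
`Ψ̂_ω(e) = uvSymbolFnXi 1 Λ ω e = W(ω,e)/(−iω + e)`, `W(ω,e) = uvWeightFn Λ ω e = χ((e²+ω²)/Λ²)` (Salmhofer cutoff: `0` below `¼`, `1` above `1`); for a FINITE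
frequency set `S` (any window of fermionic Matsubara frequencies), temperature factor `T` and transfer frequency `Ω`:
* `ppPairKernel S T Λ Ω e u = T·Σ_{ω∈S} Ψ̂_ω(e)·Ψ̂_{Ω−ω}(u)` — the pp pair kernel in the two level variables (loop line `e`, partner line `u`);
* `ppPairNumerator S T Λ Ω e u = T·Σ_{ω∈S} W(ω,e)W(Ω−ω,u)·[1/(−iω+e) + 1/(−i(Ω−ω)+u)]`.
RESULTS:
* §1 `uvDen_ne_zero_of_uvWeightFn_ne_zero` (where the weight is nonzero the line denominator is nonzero), `uvDen_add_uvDen` (the two denominators add up to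
  `e + u − iΩ`), **`uvSymbolFnXi_mul_eq_div`** (termwise partial fractions) and **`ppPairKernel_eq_numerator_div`**: `K = N/(e + u − iΩ)` whenever `e + u − iΩ ≠ 0` —
  the ratio form holds for the TRUE cutoff, frequency by frequency and hence for the Matsubara sum (finding (i) of the note);
* §2 the INSIDE simplifications: `uvSymbolFnXi_eq_resolventFnXi_of_gt` (`Λ² < e² + ω² ⟹ Ψ̂_ω(e) = 1/(−iω+e)`), **`ppPairNumerator_eq_of_far`** (on the finer-line split's
  support `Λ² < u²` the partner weight is ≡ 1: `N = T·Σ W(ω,e)[1/(−iω+e) + 1/(−i(Ω−ω)+u)]`), `ppPairNumerator_eq_of_inside` (both weights ≡ 1: the cutoff-free numerator);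
* §3 the LEVEL DERIVATIVES (the `n₁ = ∂_eN`, `n₂ = ∂_uN` data of `…C4aAntidiagonalFlatnessL1`): **`hasDerivAt_ppPairNumerator_level`** (in `e`, everywhere:
  `T·Σ W(Ω−ω,u)·[Ψ̂′_ω(e) + W′(ω,e)/(−i(Ω−ω)+u)]`, `Ψ̂′ = uvSymbolFnXiD1`, `W′ = uvWeightFnD1` — supported on the shell `e² + ω² ≤ Λ²` apart from the resolvent-square
  term) and **`hasDerivAt_ppPairNumerator_far`** (in `u` on `Λ² < u²`: `T·Σ W(ω,e)·(−1/(−i(Ω−ω)+u)²)` — NO cutoff derivative: the far line's weight is frozen at 1).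
What this does NOT do (the analytic half of (M1), note §2): the sizes `M₁, M₂` of the weighted-L¹ form, which need the cancellation ACROSS frequencies
(`TΣ_ω 1/(−iω+e)² ↔ sech²`, tree `Literature.Analysis.SpecialFunctions.tsum_int_one_div_matsubara_sq_add_sq`) — never a per-frequency absolute value (note finding (v)).
Pure algebra/calculus on Literature objects; nothing asserts (C), K3 or superconductivity.
References: BGM 2006 §2.1 (2.3), §2.4 [cite: BenfattoGiulianiMastropietro2006]; Salmhofer 1999 §4.2.5 (4.70)–(4.71) [cite: Salmhofer1999]; FST II CPAM 51 (1998) §3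
[cite: FeldmanSalmhoferTrubowitz1998].
-/

noncomputable section

namespace Summit.HubbardSuperconductivity.HubbardSuperconductivity.Theorems.C4a

set_option linter.dupNamespace false -- summit = problem name (single-conjunct summit), D-0017

open Complex Real Set Finset
open Literature.MathematicalPhysics.QuantumLattice

/-! ## §0 The objects -/

/-- **The above-scale pp PAIR KERNEL in level variables** over a finite frequency set `S`: `K_Ω(e,u) = T·Σ_{ω∈S} Ψ̂_ω(e)·Ψ̂_{Ω−ω}(u)`,
`Ψ̂_ω(e) = uvSymbolFnXi 1 Λ ω e = W(ω,e)/(−iω+e)`. -/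
def ppPairKernel (S : Finset ℝ) (T Λ Ω e u : ℝ) : ℂ :=
  (T : ℂ) * ∑ ω ∈ S, uvSymbolFnXi 1 Λ ω e * uvSymbolFnXi 1 Λ (Ω - ω) u

/-- **The pair kernel's NUMERATOR**: `N_Ω(e,u) = T·Σ_{ω∈S} W(ω,e)·W(Ω−ω,u)·[1/(−iω+e) + 1/(−i(Ω−ω)+u)]`. -/
def ppPairNumerator (S : Finset ℝ) (T Λ Ω e u : ℝ) : ℂ :=
  (T : ℂ) * ∑ ω ∈ S, ((uvWeightFn Λ ω e : ℝ) : ℂ) * ((uvWeightFn Λ (Ω - ω) u : ℝ) : ℂ) *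
    (resolventFnXi 1 0 ω e + resolventFnXi 1 0 (Ω - ω) u)

/-! ## §1 The ratio form -/

/-- Where the cutoff weight is nonzero the line denominator is nonzero: `W(ω,e) ≠ 0 ⟹ −iω + e ≠ 0` (`Λ > 0`; the weight vanishes on `e² + ω² < Λ²/4`).
[cite: Salmhofer1999, §4.2.5 (4.71)] -/
theorem uvDen_ne_zero_of_uvWeightFn_ne_zero {Λ : ℝ} (hΛ : 0 < Λ) {ω e : ℝ} (hW : uvWeightFn Λ ω e ≠ 0) :
    (-I * ((ω + 0 : ℝ) : ℂ) + (e : ℂ)) ≠ 0 := by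
  refine uvDen_ne_zero_of_gt_xi hΛ ?_
  by_contra h
  have hlt : e ^ 2 + ω ^ 2 < Λ ^ 2 / 4 := by
    have hΛ2 : 0 < Λ ^ 2 := pow_pos hΛ 2
    linarith [not_lt.1 h]
  exact hW (uvWeightFn_eq_zero_of_lt hΛ hlt).1

/-- The two line denominators of a pp pair add up to the transfer denominator: `(−iω + e) + (−i(Ω−ω) + u) = e + u − iΩ`. [folklore] -/
theorem uvDen_add_uvDen (ω Ω e u : ℝ) :
    (-I * ((ω + 0 : ℝ) : ℂ) + (e : ℂ)) + (-I * ((Ω - ω + 0 : ℝ) : ℂ) + (u : ℂ)) = (e : ℂ) + u - I * Ω := by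
  push_cast
  ring

/-- **Termwise partial fractions** for the true cutoff: `Ψ̂_ω(e)·Ψ̂_{Ω−ω}(u) = W(ω,e)W(Ω−ω,u)·[1/(−iω+e) + 1/(−i(Ω−ω)+u)]/(e + u − iΩ)` whenever `e + u − iΩ ≠ 0`
(if either weight vanishes both sides are `0`; otherwise both line denominators are nonzero and `1/(ab) = (1/a + 1/b)/(a + b)`).
[cite: BenfattoGiulianiMastropietro2006, §2.1 (2.3)] -/
theorem uvSymbolFnXi_mul_eq_div {Λ : ℝ} (hΛ : 0 < Λ) (ω Ω e u : ℝ) (hs : (e : ℂ) + u - I * Ω ≠ 0) :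
    uvSymbolFnXi 1 Λ ω e * uvSymbolFnXi 1 Λ (Ω - ω) u =
      ((uvWeightFn Λ ω e : ℝ) : ℂ) * ((uvWeightFn Λ (Ω - ω) u : ℝ) : ℂ) *
        (resolventFnXi 1 0 ω e + resolventFnXi 1 0 (Ω - ω) u) / ((e : ℂ) + u - I * Ω) := by
  by_cases h1 : uvWeightFn Λ ω e = 0
  · simp [uvSymbolFnXi, h1]
  by_cases h2 : uvWeightFn Λ (Ω - ω) u = 0
  · simp [uvSymbolFnXi, h2]
  have ha := uvDen_ne_zero_of_uvWeightFn_ne_zero hΛ h1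
  have hb := uvDen_ne_zero_of_uvWeightFn_ne_zero hΛ h2
  have hab := uvDen_add_uvDen ω Ω e u
  set a : ℂ := -I * ((ω + 0 : ℝ) : ℂ) + (e : ℂ) with ha_def
  set b : ℂ := -I * ((Ω - ω + 0 : ℝ) : ℂ) + (u : ℂ) with hb_def
  rw [← hab]
  unfold uvSymbolFnXi resolventFnXi
  rw [← ha_def, ← hb_def]
  have hab0 : a + b ≠ 0 := by rw [hab]; exact hs
  field_simp
  push_cast
  ring

/-- **THE RATIO FORM OF THE TRUE pp PAIR KERNEL**: `K_Ω(e,u) = N_Ω(e,u)/(e + u − iΩ)` whenever `e + u − iΩ ≠ 0` (any finite frequency set, any `T`).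
[cite: BenfattoGiulianiMastropietro2006, §2.1 (2.3)] -/
theorem ppPairKernel_eq_numerator_div {Λ : ℝ} (hΛ : 0 < Λ) (S : Finset ℝ) (T Ω e u : ℝ) (hs : (e : ℂ) + u - I * Ω ≠ 0) :
    ppPairKernel S T Λ Ω e u = ppPairNumerator S T Λ Ω e u / ((e : ℂ) + u - I * Ω) := by
  unfold ppPairKernel ppPairNumerator
  rw [mul_div_assoc, Finset.sum_div]
  congr 1
  refine Finset.sum_congr rfl fun ω _ => ?_
  exact uvSymbolFnXi_mul_eq_div hΛ ω Ω e u hs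

/-! ## §2 Inside the shell the weights are frozen at one -/

/-- Above the shell the profile is the bare resolvent: `Λ² < e² + ω² ⟹ Ψ̂_ω(e) = c/(−iω+e)`. [cite: Salmhofer1999, §4.2.5 (4.71)] -/
theorem uvSymbolFnXi_eq_resolventFnXi_of_gt {c Λ ω e : ℝ} (hΛ : 0 < Λ) (h : Λ ^ 2 < e ^ 2 + ω ^ 2) :
    uvSymbolFnXi c Λ ω e = resolventFnXi c 0 ω e := by
  rw [uvSymbolFnXi, (uvWeightFn_eq_one_of_gt hΛ h).1, Complex.ofReal_one, one_mul]

/-- The partner weight is one on the far region: `Λ² < u² ⟹ W(Ω−ω, u) = 1` for every frequency. [cite: Salmhofer1999, §4.2.5 (4.71)] -/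
theorem uvWeightFn_partner_eq_one_of_far {Λ : ℝ} (hΛ : 0 < Λ) {u : ℝ} (hu : Λ ^ 2 < u ^ 2) (ν : ℝ) : uvWeightFn Λ ν u = 1 :=
  (uvWeightFn_eq_one_of_gt hΛ (by nlinarith [sq_nonneg ν])).1

/-- **The numerator on the finer-line split's support** (`Λ² < u²`: the partner line is above the shell for EVERY frequency):
`N_Ω(e,u) = T·Σ_{ω∈S} W(ω,e)·[1/(−iω+e) + 1/(−i(Ω−ω)+u)]` — only the loop line's weight survives. [cite: Salmhofer1999, §4.2.5 (4.70)–(4.71)] -/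
theorem ppPairNumerator_eq_of_far {Λ : ℝ} (hΛ : 0 < Λ) (S : Finset ℝ) (T Ω e : ℝ) {u : ℝ} (hu : Λ ^ 2 < u ^ 2) :
    ppPairNumerator S T Λ Ω e u =
      (T : ℂ) * ∑ ω ∈ S, ((uvWeightFn Λ ω e : ℝ) : ℂ) * (resolventFnXi 1 0 ω e + resolventFnXi 1 0 (Ω - ω) u) := by
  unfold ppPairNumerator
  congr 1
  refine Finset.sum_congr rfl fun ω _ => ?_
  rw [uvWeightFn_partner_eq_one_of_far hΛ hu, Complex.ofReal_one, mul_one]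

/-- **The cutoff-free numerator** when both lines are above the shell (`Λ² < e²`, `Λ² < u²`): `N_Ω(e,u) = T·Σ_{ω∈S} [1/(−iω+e) + 1/(−i(Ω−ω)+u)]`
(for a full fermionic Matsubara set and `Ω = 0` its real part is `½[tanh(e/2T) + tanh(u/2T)]`, a window tail away). [cite: BenfattoGiulianiMastropietro2006, §2.1 (2.3)] -/
theorem ppPairNumerator_eq_of_inside {Λ : ℝ} (hΛ : 0 < Λ) (S : Finset ℝ) (T Ω : ℝ) {e u : ℝ} (he : Λ ^ 2 < e ^ 2) (hu : Λ ^ 2 < u ^ 2) :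
    ppPairNumerator S T Λ Ω e u = (T : ℂ) * ∑ ω ∈ S, (resolventFnXi 1 0 ω e + resolventFnXi 1 0 (Ω - ω) u) := by
  rw [ppPairNumerator_eq_of_far hΛ S T Ω e hu]
  congr 1
  refine Finset.sum_congr rfl fun ω _ => ?_
  rw [uvWeightFn_partner_eq_one_of_far hΛ he, Complex.ofReal_one, one_mul]

/-! ## §3 The level derivatives of the numerator -/

/-- One summand of the numerator as a function of the loop level: `W(ω,x)W₂·[r_ω(x) + r₂] = W₂·[Ψ̂_ω(x) + W(ω,x)·r₂]`. [folklore] -/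
theorem ppPairNumerator_summand_eq (Λ ω Ω e u : ℝ) :
    ((uvWeightFn Λ ω e : ℝ) : ℂ) * ((uvWeightFn Λ (Ω - ω) u : ℝ) : ℂ) * (resolventFnXi 1 0 ω e + resolventFnXi 1 0 (Ω - ω) u) =
      ((uvWeightFn Λ (Ω - ω) u : ℝ) : ℂ) * (uvSymbolFnXi 1 Λ ω e + ((uvWeightFn Λ ω e : ℝ) : ℂ) * resolventFnXi 1 0 (Ω - ω) u) := by
  unfold uvSymbolFnXi
  ring

/-- **`∂_e N_Ω(e,u)`** (everywhere; `Λ > 0`): `T·Σ_{ω∈S} W(Ω−ω,u)·[Ψ̂′_ω(e) + W′(ω,e)·1/(−i(Ω−ω)+u)]` with `Ψ̂′ = uvSymbolFnXiD1 1 Λ ω e` and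
`W′(ω,e) = uvWeightFnD1 Λ ω e` — the cutoff derivatives live on the shell `Λ²/4 ≤ e² + ω² ≤ Λ²` (`|ω|, |e| ≤ Λ`), the resolvent-square part of `Ψ̂′` does not.
[cite: BenfattoGiulianiMastropietro2006, §2.4 (2.36)] -/
theorem hasDerivAt_ppPairNumerator_level {Λ : ℝ} (hΛ : 0 < Λ) (S : Finset ℝ) (T Ω e u : ℝ) :
    HasDerivAt (fun x => ppPairNumerator S T Λ Ω x u)
      ((T : ℂ) * ∑ ω ∈ S, ((uvWeightFn Λ (Ω - ω) u : ℝ) : ℂ) *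
        (uvSymbolFnXiD1 1 Λ ω e + ((uvWeightFnD1 Λ ω e : ℝ) : ℂ) * resolventFnXi 1 0 (Ω - ω) u)) e := by
  unfold ppPairNumerator
  simp_rw [ppPairNumerator_summand_eq]
  refine HasDerivAt.const_mul (T : ℂ) (HasDerivAt.fun_sum fun ω _ => ?_)
  have h1 : HasDerivAt (fun x => uvSymbolFnXi 1 Λ ω x) (uvSymbolFnXiD1 1 Λ ω e) e := hasDerivAt_uvSymbolFnXi hΛ e
  have h2 : HasDerivAt (fun x => ((uvWeightFn Λ ω x : ℝ) : ℂ) * resolventFnXi 1 0 (Ω - ω) u)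
      (((uvWeightFnD1 Λ ω e : ℝ) : ℂ) * resolventFnXi 1 0 (Ω - ω) u) e :=
    (hasDerivAt_uvWeightFn Λ ω e).ofReal_comp.mul_const _
  exact (h1.add h2).const_mul _

/-- **`∂_u N_Ω(e,u)` on the far region `Λ² < u²`**: `T·Σ_{ω∈S} W(ω,e)·(−1/(−i(Ω−ω)+u)²)` (`= T·Σ W(ω,e)·resolventFnXiD1 1 0 (Ω−ω) u`) — the partner
weight is frozen at `1` near `u`, so no cutoff derivative appears. [cite: BenfattoGiulianiMastropietro2006, §2.4 (2.36)] -/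
theorem hasDerivAt_ppPairNumerator_far {Λ : ℝ} (hΛ : 0 < Λ) (S : Finset ℝ) (T Ω e : ℝ) {u : ℝ} (hu : Λ ^ 2 < u ^ 2) :
    HasDerivAt (fun v => ppPairNumerator S T Λ Ω e v)
      ((T : ℂ) * ∑ ω ∈ S, ((uvWeightFn Λ ω e : ℝ) : ℂ) * resolventFnXiD1 1 0 (Ω - ω) u) u := by
  -- near `u` the partner line stays above the shell
  have hopen : ∀ᶠ v in nhds u, Λ ^ 2 < v ^ 2 := (continuous_pow 2).continuousAt.eventually_const_lt hu
  have hev : (fun v => ppPairNumerator S T Λ Ω e v) =ᶠ[nhds u]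
      fun v => (T : ℂ) * ∑ ω ∈ S, ((uvWeightFn Λ ω e : ℝ) : ℂ) * (resolventFnXi 1 0 ω e + resolventFnXi 1 0 (Ω - ω) v) := by
    filter_upwards [hopen] with v hv
    exact ppPairNumerator_eq_of_far hΛ S T Ω e hv
  refine HasDerivAt.congr_of_eventuallyEq ?_ hev
  refine HasDerivAt.const_mul (T : ℂ) (HasDerivAt.fun_sum fun ω _ => ?_)
  have hden : (-I * ((Ω - ω + 0 : ℝ) : ℂ) + (u : ℂ)) ≠ 0 :=
    uvDen_ne_zero_of_gt_xi hΛ (by nlinarith [sq_nonneg (Ω - ω), pow_pos hΛ 2])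
  have h2 : HasDerivAt (fun v => resolventFnXi 1 0 (Ω - ω) v) (resolventFnXiD1 1 0 (Ω - ω) u) u := hasDerivAt_resolventFnXi hden
  exact ((h2.const_add (resolventFnXi 1 0 ω e)).const_mul _)

/-- **`∂_e N_Ω(e,u)` on the far region** (`Λ² < u²`): `T·Σ_{ω∈S} [Ψ̂′_ω(e) + W′(ω,e)/(−i(Ω−ω)+u)]` — the partner weight drops out.
[cite: BenfattoGiulianiMastropietro2006, §2.4 (2.36)] -/
theorem hasDerivAt_ppPairNumerator_level_far {Λ : ℝ} (hΛ : 0 < Λ) (S : Finset ℝ) (T Ω e : ℝ) {u : ℝ} (hu : Λ ^ 2 < u ^ 2) :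
    HasDerivAt (fun x => ppPairNumerator S T Λ Ω x u)
      ((T : ℂ) * ∑ ω ∈ S, (uvSymbolFnXiD1 1 Λ ω e + ((uvWeightFnD1 Λ ω e : ℝ) : ℂ) * resolventFnXi 1 0 (Ω - ω) u)) e := by
  have h := hasDerivAt_ppPairNumerator_level hΛ S T Ω e u
  refine h.congr_deriv ?_
  congr 1
  refine Finset.sum_congr rfl fun ω _ => ?_
  rw [uvWeightFn_partner_eq_one_of_far hΛ hu, Complex.ofReal_one, one_mul]

end Summit.HubbardSuperconductivity.HubbardSuperconductivity.Theorems.C4a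

end
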